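import Summits.ResolutionOfSingularities.ResolutionOfSingularities.Theorems.PurelyInseparableDim4ResConeLayerBirths
import HarnessLib
import HarnessLib.Audit.Tags

/-!
# Purely inseparable four-folds — THE NEW RESIDUAL POLYNOMIAL RESTRICTED TO THE NEW EXCEPTIONAL DIVISOR
# (K2(p) lane, slice B, memo (K3) «LEDGER SEED»; cell `res-dim4-pi`)

[OURS · counted 0 · cell `res-dim4-pi` · K2(p) lane holder res-dim4-p-12 g3's SLICE-B KERNEL ARCHITECTURE MEMO v1,
brick (K3), seat res-dim4-p-3 g3.]  Nothing here proves K2(p), `NoIsolatedTrap p p` or resolution of singularities in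
dimension ≥ 4 / characteristic `p`.  AI kernel work, weaker than expert review.

Setting (`…ResConeLayerBirths` and its imports): state `s = (F, r, exc)`, `x^r ∣ F` monomialwise, `ord₀ F = o` in
the band `q < o < 2q`, residual cone `g = resForm s`, point step at the chart point `b` of the `x_j`-chart
(`b_j = 0`), `s′ = CentreBlowup.step q univ j b s`, `r′ = (r|_{b = 0}).update j (o − q)`, new residual POLYNOMIAL
`G′ = F′ / x^{r′}`.  The monomials of `G′|_{x_j = 0}` (`PointBlowup.killVar j G′`) are the monomials of `F′` of
`x_j`-exponent EXACTLY `o − q ∈ [1, q − 1]`: their sources are the degree-`o` monomials of `shear j b F` (the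
sheared initial form) and the cleaning never touches them.
* §1 the substitution `x_j ↦ 1`: `aeval_update_X_one_monomial`, `coeff_aeval_update_X_one_of_isHomogeneous`,
  `aeval_update_X_one_eq_self_of_free`, `aeval_update_X_one_shear`, `aeval_shift_monomial`.
* §2 **`monomial_mul_killVar_divMonomial_step`** (`x^{ρ} · G′|_{x_j=0} = (shear j b (in F))|_{x_j = 1}`,
  `ρ = (r|_{b=0}).erase j`, EVERY band step); **`killVar_divMonomial_step'`**
  (`G′|_{x_j = 0} = (∏_{b_i ≠ 0} (x_i + b_i)^{r_i}) · (shear j b g)|_{x_j = 1}`); **`killVar_divMonomial_step`** —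
  at a SHADE-KEEPING step `shear j b g` is `x_j`-free (`…ResConeNear`), so
  `G′|_{x_j = 0} = (∏_{b_i ≠ 0} (x_i + b_i)^{r_i}) · shear j b g`: «the new residual polynomial restricted to
  `E_j` is the sheared old cone times the lost units» (I-4-7 (LEDGER) seed).
* §3 power cones: `killVar_divMonomial_step_of_powerCone` (`g = a·L^d`, `ℓ_j + L(b) = 0` ⇒
  `G′|_{x_j=0} = a · ∏ (x_i + b_i)^{r_i} · L̃^d`, `L̃ = L|_{x_j = 0}`), `divMonomial_step_mem_span_of_powerCone`
  (`G′ ∈ (x_j, L̃^d)`), `span_X_pow_eq_of_sub_mem` (`(x_j, L^d) = (x_j, M^d)` when `M − L ∈ (x_j)`).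
No characteristic hypothesis.  bears_on: LADDER-RESOLUTION:D157-DOOR2 (res-dim4-pi · K2(p) · slice B (K3)).
Supports stmt-ResolutionOfSingularities-16155 (helper).
-/

set_option linter.dupNamespace false -- mandated namespace of this single-conjunct summit

noncomputable section

namespace Summit.ResolutionOfSingularities.ResolutionOfSingularities.Theorems.PIDim4

namespace ResCone

open MvPolynomial Finset
open Literature.AlgebraicGeometry.Resolution
open Literature.AlgebraicGeometry.Resolution.CentreBlowup
open Literature.AlgebraicGeometry.Resolution.Hauser2010
open Literature.AlgebraicGeometry.Resolution.HauserPerlega2019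
open PointBlowup (polarMap additiveSubspace direction)

variable {K : Type} [Field K]

/-! ## 1. The substitution `x_j ↦ 1` -/

/-- `x_j ↦ 1` on a monomial: `x^e ↦ x^{e.erase j}`. [folklore] -/
theorem aeval_update_X_one_monomial (j : Fin 4) (e : Fin 4 →₀ ℕ) (c : K) :
    aeval (Function.update X j (1 : MvPolynomial (Fin 4) K)) (monomial e c) =
      monomial (e.erase j) c := by
  rw [aeval_monomial, algebraMap_eq, Finsupp.prod_fintype _ _ (fun i => pow_zero _),
    monomial_eq, Finsupp.prod_fintype _ _ (fun i => pow_zero _)]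
  congr 1
  refine Finset.prod_congr rfl fun i _ => ?_
  by_cases hij : i = j
  · subst hij; rw [Function.update_self, one_pow, Finsupp.erase_same, pow_zero]
  · rw [Function.update_of_ne hij, Finsupp.erase_ne hij]

/-- **Coefficients of `Q(x_j ↦ 1)` for a FORM `Q` of degree `n`**: `coeff_η = coeff_{η + (n − |η|) e_j} Q` when
`η_j = 0`, `|η| ≤ n`, else `0`. [folklore] -/
theorem coeff_aeval_update_X_one_of_isHomogeneous (j : Fin 4) {Q : MvPolynomial (Fin 4) K} {n : ℕ}
    (hQ : Q.IsHomogeneous n) (η : Fin 4 →₀ ℕ) :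
    coeff η (aeval (Function.update X j (1 : MvPolynomial (Fin 4) K)) Q) =
      if η j = 0 ∧ η.degree ≤ n then coeff (η + Finsupp.single j (n - η.degree)) Q else 0 := by
  classical
  conv_lhs => rw [Q.as_sum, map_sum, coeff_sum]
  simp_rw [aeval_update_X_one_monomial, coeff_monomial]
  split_ifs with h
  · obtain ⟨hj, hle⟩ := h
    -- the only possible source is `e₀ = η + (n − |η|) e_j`
    have hiff : ∀ e ∈ Q.support, (e.erase j = η ↔ η + Finsupp.single j (n - η.degree) = e) := by
      intro e he
      have hdeg : e.degree = n := by
        have := hQ (MvPolynomial.mem_support_iff.mp he)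
        rwa [weight_one_eq_degree] at this
      constructor
      · intro h1
        have h2 : e = e.erase j + Finsupp.single j (e j) := (Finsupp.erase_add_single j e).symm
        rw [h1] at h2
        have h3 : e j = n - η.degree := by
          have := congrArg Finsupp.degree h2
          rw [map_add, Finsupp.degree_single, hdeg] at this
          omega
        rw [← h3]
        exact h2.symm
      · intro h1
        rw [← h1, Finsupp.erase_add, Finsupp.erase_single, add_zero, Finsupp.erase_of_notMem_support]
        exact Finsupp.notMem_support_iff.mpr hj
    rw [Finset.sum_congr rfl fun e he => if_congr (hiff e he) rfl rfl, Finset.sum_ite_eq]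
    split_ifs with hmem
    · rfl
    · exact (MvPolynomial.notMem_support_iff.mp hmem).symm
  · refine Finset.sum_eq_zero fun e he => ?_
    rw [if_neg]
    intro h1
    apply h
    have hdeg : e.degree = n := by
      have := hQ (MvPolynomial.mem_support_iff.mp he)
      rwa [weight_one_eq_degree] at this
    constructor
    · rw [← h1, Finsupp.erase_same]
    · have h2 : e = e.erase j + Finsupp.single j (e j) := (Finsupp.erase_add_single j e).symm
      have := congrArg Finsupp.degree h2
      rw [map_add, Finsupp.degree_single, hdeg, h1] at this
      omega

/-- `Q(x_j ↦ 1) = Q` for an `x_j`-free `Q`. [folklore] -/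
theorem aeval_update_X_one_eq_self_of_free (j : Fin 4) {Q : MvPolynomial (Fin 4) K}
    (h : ∀ e ∈ Q.support, e j = 0) :
    aeval (Function.update X j (1 : MvPolynomial (Fin 4) K)) Q = Q := by
  classical
  conv_lhs => rw [Q.as_sum, map_sum]
  conv_rhs => rw [Q.as_sum]
  refine Finset.sum_congr rfl fun e he => ?_
  rw [aeval_update_X_one_monomial, Finsupp.erase_of_notMem_support]
  exact Finsupp.notMem_support_iff.mpr (h e he)

/-- **`(x_j ↦ 1) ∘ shear j b`** is the substitution `x_i ↦ x_i + b_i` (`i ≠ j`), `x_j ↦ 1`. [folklore] -/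
theorem aeval_update_X_one_shear (j : Fin 4) (b : Fin 4 → K) (P : MvPolynomial (Fin 4) K) :
    aeval (Function.update X j (1 : MvPolynomial (Fin 4) K)) (shear j b P) =
      aeval (fun i => if i = j then (1 : MvPolynomial (Fin 4) K) else X i + C (b i)) P := by
  have hfun : (fun i => aeval (Function.update X j (1 : MvPolynomial (Fin 4) K))
      (if i = j then (X j : MvPolynomial (Fin 4) K) else X i + C (b i) * X j)) =
      (fun i => if i = j then (1 : MvPolynomial (Fin 4) K) else X i + C (b i)) := by
    funext i
    by_cases hij : i = j
    · subst hij; rw [if_pos rfl, if_pos rfl, aeval_X, Function.update_self]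
    · rw [if_neg hij, if_neg hij, map_add, map_mul, aeval_X, aeval_X, aeval_C, algebraMap_eq,
        Function.update_of_ne hij, Function.update_self, mul_one]
  unfold shear
  rw [comp_aeval_apply, hfun]

/-- The substitution `x_i ↦ x_i + b_i` (`i ≠ j`), `x_j ↦ 1` on the boundary monomial `x^r`:
`x^{(r|_{b=0}).erase j} · ∏_{b_i ≠ 0} (x_i + b_i)^{r_i}`. [folklore] -/
theorem aeval_shift_monomial [DecidableEq K] (j : Fin 4) {b : Fin 4 → K} (hbj : b j = 0) (r : Fin 4 →₀ ℕ) :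
    aeval (fun i => if i = j then (1 : MvPolynomial (Fin 4) K) else X i + C (b i)) (monomial r (1 : K)) =
      monomial ((r.filter (fun i => b i = 0)).erase j) 1 *
        ∏ i ∈ Finset.univ.filter (fun i => b i ≠ 0), (X i + C (b i)) ^ (r i) := by
  rw [aeval_monomial, algebraMap_eq, C_1, one_mul, Finsupp.prod_fintype _ _ (fun i => pow_zero _),
    monomial_eq, C_1, one_mul, Finsupp.prod_fintype _ _ (fun i => pow_zero _), Finset.prod_filter,
    ← Finset.prod_mul_distrib]
  refine Finset.prod_congr rfl fun i _ => ?_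
  by_cases hij : i = j
  · subst hij; rw [if_pos rfl, one_pow, Finsupp.erase_same, pow_zero, if_neg (not_not.mpr hbj), one_mul]
  · rw [if_neg hij, Finsupp.erase_ne hij, Finsupp.filter_apply]
    by_cases hbi : b i = 0
    · rw [if_pos hbi, if_neg (not_not.mpr hbi), hbi, C_0, add_zero, mul_one]
    · rw [if_neg hbi, if_pos hbi, pow_zero, one_mul]

/-! ## 2. The new residual polynomial on `E_j` -/

section Step

variable [DecidableEq K]

/-- Every monomial of the sheared initial form lies above the kept boundary `x^{r|_{b=0}}`. [folklore] -/
theorem filter_le_of_mem_support_shear_initialForm (j : Fin 4) {b : Fin 4 → K} (hbj : b j = 0) {s : State K}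
    (hr : ∀ d ∈ s.F.support, s.r ≤ d) {e : Fin 4 →₀ ℕ} (he : e ∈ (shear j b (initialForm s.F)).support) :
    s.r.filter (fun i => b i = 0) ≤ e := by
  rw [← monomial_mul_resForm hr, shear_mul, shear_monomial_eq_mul j hbj, mul_assoc, MvPolynomial.mem_support_iff,
    coeff_monomial_mul'] at he
  by_contra h
  exact he (if_neg h)

/-- **`x^{ρ} · G′|_{x_j = 0} = (shear j b (in F))|_{x_j = 1}`**, `ρ = (r|_{b=0}).erase j`, at EVERY point step of
the band `q < ord₀ F = o < 2q` (`x^r ∣ F`, `b_j = 0`): the monomials of `F′` on `E_j` (`x_j`-exponent exactly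
`r′_j = o − q`, prime to `q`, never cleaned) are the chart images of the degree-`o` monomials of `shear j b F`.
[OURS] [cite: CossartJannsenSaito2020, Thm. 3.10(4), Thm. 9.3] -/
theorem monomial_mul_killVar_divMonomial_step {q : ℕ} (j : Fin 4) {b : Fin 4 → K} (hbj : b j = 0)
    {s : State K} {o : ℕ} (ho : ordZero s.F = o) (hr : ∀ d ∈ s.F.support, s.r ≤ d) (hqo : q < o)
    (ho2 : o < 2 * q) :
    monomial ((s.r.filter (fun i => b i = 0)).erase j) (1 : K) *
        PointBlowup.killVar j ((CentreBlowup.step q Finset.univ j b s).F.divMonomial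
          (CentreBlowup.step q Finset.univ j b s).r) =
      aeval (Function.update X j (1 : MvPolynomial (Fin 4) K)) (shear j b (initialForm s.F)) := by
  have hq : (q : ℕ∞) ≤ ordAlong Finset.univ s.F := by
    rw [ordAlong_univ, ho]; exact_mod_cast hqo.le
  have hq' := Straightening.le_ordAlong_univ_shear j b hq
  have hr' := step_r_univ q j hbj s ho hr
  set ρ := (s.r.filter (fun i => b i = 0)).erase j with hρ
  have hρj : ρ j = 0 := by rw [hρ, Finsupp.erase_same]
  have hr'' : (CentreBlowup.step q Finset.univ j b s).r = ρ + Finsupp.single j (o - q) := by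
    rw [hr', hρ, Finsupp.update_eq_erase_add_single]
  ext η
  rw [coeff_monomial_mul', coeff_aeval_update_X_one_of_isHomogeneous j (isHomogeneous_shear_initialForm j b ho)]
  by_cases hle : ρ ≤ η
  · rw [if_pos hle, one_mul, coeff_killVar]
    have hγj : (η - ρ) j = η j := by rw [Finsupp.tsub_apply, hρj, Nat.sub_zero]
    by_cases hηj : η j = 0
    · rw [if_pos (hγj.trans hηj), coeff_divMonomial, hr'',
        show ρ + Finsupp.single j (o - q) + (η - ρ) = η + Finsupp.single j (o - q) by
          rw [add_right_comm, add_tsub_cancel_of_le hle]]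
      by_cases hdeg : η.degree ≤ o
      · rw [if_pos ⟨hηj, hdeg⟩]
        -- the source monomial `e = η + (o − |η|) e_j`, of degree `o`
        have hedeg : (η + Finsupp.single j (o - η.degree)).degree = o := by
          rw [map_add, Finsupp.degree_single]; omega
        have hE : chartExponent q Finset.univ j (η + Finsupp.single j (o - η.degree)) =
            η + Finsupp.single j (o - q) := by
          ext i
          by_cases hij : i = j
          · rw [hij, chartExponent_univ_apply_self, hedeg, Finsupp.add_apply, hηj, Finsupp.single_eq_same,
              zero_add]
          · rw [chartExponent_apply_of_ne q Finset.univ hij, Finsupp.add_apply, Finsupp.add_apply,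
              Finsupp.single_eq_of_ne hij, Finsupp.single_eq_of_ne hij]
        rw [← hE, coeff_step_F_chartExponent q j hbj s hq (by rw [hedeg]; exact hqo.le), if_neg,
          coeff_shear_eq_coeff_shear_initialForm_of_degree_eq j b ho hedeg]
        -- `x_j`-exponent `o − q ∈ [1, q−1]` is prime to `q`
        intro hP
        have h := (isPthPowerExponent_iff q _).mp hP j
        rw [hE, Finsupp.add_apply, hηj, Finsupp.single_eq_same, zero_add] at h
        have := Nat.le_of_dvd (by omega) h
        omega
      · rw [if_neg (fun h => hdeg h.2)]
        -- no source: a monomial of `F′` with `x_j`-exponent `o − q` has the other exponents summing to `≤ o`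
        by_contra hne
        obtain ⟨e, he, heE, -⟩ := exists_of_mem_support_step q j hbj s hq
          (MvPolynomial.mem_support_iff.mpr hne)
        have hedeg : q ≤ e.degree := le_degree_of_mem_support hq' he
        have hj := congrArg (fun f : Fin 4 →₀ ℕ => f j) heE
        simp only [chartExponent_univ_apply_self, Finsupp.coe_add, Pi.add_apply, hηj,
          Finsupp.single_eq_same, zero_add] at hj
        have hsum : η.degree + e j = e.degree := by
          have h1 : ∀ i, i ≠ j → e i = η i := fun i hij => by
            have := congrArg (fun f : Fin 4 →₀ ℕ => f i) heE
            simp only [chartExponent_apply_of_ne q Finset.univ hij, Finsupp.coe_add, Pi.add_apply,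
              Finsupp.single_eq_of_ne hij, add_zero] at this
            exact this
          rw [Finsupp.degree_eq_sum, Finsupp.degree_eq_sum, ← Finset.sum_erase_add _ _ (Finset.mem_univ j),
            ← Finset.sum_erase_add _ (⇑e) (Finset.mem_univ j), hηj, add_zero]
          congr 1
          exact Finset.sum_congr rfl fun i hi => (h1 i (Finset.ne_of_mem_erase hi)).symm
        omega
    · rw [if_neg (by rw [hγj]; exact hηj), if_neg (fun h => hηj h.1)]
  · rw [if_neg hle]
    split_ifs with h
    · -- every monomial of the sheared initial form lies above `x^{r|_{b=0}} ≥ x^ρ`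
      by_contra hne
      have hmem := MvPolynomial.mem_support_iff.mpr (Ne.symm hne)
      have hfl := filter_le_of_mem_support_shear_initialForm j hbj hr hmem
      apply hle
      intro i
      by_cases hij : i = j
      · rw [hij, hρj]; exact Nat.zero_le _
      · have := hfl i
        rw [Finsupp.add_apply, Finsupp.single_eq_of_ne hij, add_zero] at this
        rw [hρ, Finsupp.erase_ne hij]
        exact this
    · rfl

/-- **THE NEW RESIDUAL POLYNOMIAL ON `E_j`, every band step**:
`G′|_{x_j = 0} = (∏_{b_i ≠ 0} (x_i + b_i)^{r_i}) · (shear j b g)|_{x_j = 1}`. [OURS]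
[cite: CossartJannsenSaito2020, Thm. 3.10(4), Thm. 9.3] -/
theorem killVar_divMonomial_step' {q : ℕ} (j : Fin 4) {b : Fin 4 → K} (hbj : b j = 0) {s : State K} {o : ℕ}
    (ho : ordZero s.F = o) (hr : ∀ d ∈ s.F.support, s.r ≤ d) (hqo : q < o) (ho2 : o < 2 * q) :
    PointBlowup.killVar j ((CentreBlowup.step q Finset.univ j b s).F.divMonomial
        (CentreBlowup.step q Finset.univ j b s).r) =
      (∏ i ∈ Finset.univ.filter (fun i => b i ≠ 0), (X i + C (b i)) ^ (s.r i)) *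
        aeval (Function.update X j (1 : MvPolynomial (Fin 4) K)) (shear j b (resForm s)) := by
  have h := monomial_mul_killVar_divMonomial_step j hbj ho hr hqo ho2
  rw [← monomial_mul_resForm hr, shear_mul, map_mul, aeval_update_X_one_shear j b (monomial s.r 1),
    aeval_shift_monomial j hbj, mul_assoc] at h
  have h0 : monomial ((s.r.filter (fun i => b i = 0)).erase j) (1 : K) ≠ 0 :=
    monomial_eq_zero.not.mpr one_ne_zero
  exact mul_left_cancel₀ h0 h

/-- **THE NEW RESIDUAL POLYNOMIAL ON `E_j` AT A SHADE-KEEPING STEP** (memo (K3), I-4-7 (LEDGER) seed):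
`G′|_{x_j = 0} = (∏_{b_i ≠ 0} (x_i + b_i)^{r_i}) · shear j b g` — the sheared old cone times the lost units
(at constant shade the sheared cone is `x_j`-free, `…ResConeNear.shear_resForm_free_of_shade_eq`). [OURS]
[cite: CossartJannsenSaito2020, Thm. 3.10(4), Thm. 9.3] -/
theorem killVar_divMonomial_step {q : ℕ} (j : Fin 4) {b : Fin 4 → K} (hbj : b j = 0) {s : State K} {o : ℕ}
    (ho : ordZero s.F = o) (hr : ∀ d ∈ s.F.support, s.r ≤ d) (hqo : q < o) (ho2 : o < 2 * q)
    (heq : (CentreBlowup.step q Finset.univ j b s).shade = s.shade) :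
    PointBlowup.killVar j ((CentreBlowup.step q Finset.univ j b s).F.divMonomial
        (CentreBlowup.step q Finset.univ j b s).r) =
      (∏ i ∈ Finset.univ.filter (fun i => b i ≠ 0), (X i + C (b i)) ^ (s.r i)) * shear j b (resForm s) := by
  rw [killVar_divMonomial_step' j hbj ho hr hqo ho2,
    aeval_update_X_one_eq_self_of_free j (shear_resForm_free_of_shade_eq j hbj ho hr hqo ho2 heq)]

end Step

/-! ## 3. Power cones: `G′ ∈ (x_j, L̃^d)` -/

/-- `x_j ↦ 1` after the shear on a linear form: `L ↦ L̃ + (L(b) + ℓ_j)`, `L̃ = Σ_{i ≠ j} ℓ_i x_i`. [folklore] -/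
theorem aeval_shift_linearForm (j : Fin 4) (b : Fin 4 → K) (ℓ : Fin 4 → K) :
    aeval (fun i => if i = j then (1 : MvPolynomial (Fin 4) K) else X i + C (b i))
        (∑ i, C (ℓ i) * X i) =
      (∑ i, C (Function.update ℓ j 0 i) * X i) + C (ℓ j + ∑ i, ℓ i * b i * (if i = j then 0 else 1)) := by
  have hterm : ∀ i, aeval (fun i => if i = j then (1 : MvPolynomial (Fin 4) K) else X i + C (b i))
      (C (ℓ i) * X i) = C (Function.update ℓ j 0 i) * X i +
        (C (ℓ i * b i * (if i = j then 0 else 1)) + (if i = j then C (ℓ j) else 0)) := by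
    intro i
    rw [map_mul, aeval_C, algebraMap_eq, aeval_X]
    by_cases hij : i = j
    · subst hij; simp
    · rw [if_neg hij, if_neg hij, if_neg hij, Function.update_of_ne hij, mul_one, add_zero, C_mul, mul_add]
  rw [map_sum, Finset.sum_congr rfl (fun i _ => hterm i), Finset.sum_add_distrib, Finset.sum_add_distrib,
    Finset.sum_ite_eq', if_pos (Finset.mem_univ _), map_add, map_sum]
  ring

/-- **Power cones on `E_j`**: if `g = a · L^d`, `L = Σ ℓ_i x_i`, and `ℓ_j + L(b) = 0` (the near direction
`e_j + b` lies on `{L = 0}`), then at every band step `G′|_{x_j = 0} = a · (∏_{b_i ≠ 0} (x_i + b_i)^{r_i}) · L̃^d`,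
`L̃ = Σ_{i ≠ j} ℓ_i x_i`. [OURS] [cite: CossartJannsenSaito2020, Thm. 3.10(4), Thm. 9.3] -/
theorem killVar_divMonomial_step_of_powerCone [DecidableEq K] {q : ℕ} (j : Fin 4) {b : Fin 4 → K}
    (hbj : b j = 0) {s : State K} {o : ℕ} (ho : ordZero s.F = o) (hr : ∀ d ∈ s.F.support, s.r ≤ d)
    (hqo : q < o) (ho2 : o < 2 * q) {a : K} {ℓ : Fin 4 → K} {d : ℕ}
    (hg : resForm s = C a * (∑ i, C (ℓ i) * X i) ^ d)
    (hℓb : ℓ j + ∑ i, ℓ i * b i * (if i = j then 0 else 1) = 0) :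
    PointBlowup.killVar j ((CentreBlowup.step q Finset.univ j b s).F.divMonomial
        (CentreBlowup.step q Finset.univ j b s).r) =
      C a * (∏ i ∈ Finset.univ.filter (fun i => b i ≠ 0), (X i + C (b i)) ^ (s.r i)) *
        (∑ i, C (Function.update ℓ j 0 i) * X i) ^ d := by
  rw [killVar_divMonomial_step' j hbj ho hr hqo ho2, aeval_update_X_one_shear j b, hg, map_mul, map_pow,
    aeval_C, algebraMap_eq, aeval_shift_linearForm, hℓb, C_0, add_zero]
  ring

/-- `P|_{x_j = 0} ≡ P (mod x_j)`: `P − killVar j P ∈ (x_j)`. [folklore] -/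
theorem sub_killVar_mem_span_X (j : Fin 4) (P : MvPolynomial (Fin 4) K) :
    P - PointBlowup.killVar j P ∈ Ideal.span {(X j : MvPolynomial (Fin 4) K)} := by
  classical
  induction P using MvPolynomial.induction_on with
  | C a =>
    unfold PointBlowup.killVar
    rw [aeval_C, algebraMap_eq, sub_self]
    exact Ideal.zero_mem _
  | add f g hf hg =>
    rw [map_add, add_sub_add_comm]
    exact Ideal.add_mem _ hf hg
  | mul_X f i hf =>
    rw [map_mul]
    by_cases hij : i = j
    · subst hij; have hX : PointBlowup.killVar i (X i : MvPolynomial (Fin 4) K) = 0 := by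
        unfold PointBlowup.killVar; rw [aeval_X, if_pos rfl]
      rw [hX, mul_zero, sub_zero]
      exact Ideal.mul_mem_left _ _ (Ideal.subset_span rfl)
    · have hX : PointBlowup.killVar j (X i : MvPolynomial (Fin 4) K) = X i := by
        unfold PointBlowup.killVar; rw [aeval_X, if_neg hij]
      rw [hX, ← sub_mul]
      exact Ideal.mul_mem_right _ _ hf

/-- **`G′ ∈ (x_j, L̃^d)`** on a power-cone band step with `ℓ_j + L(b) = 0` (I-4-7 (LEDGER) «`G′ ≡ unit·v̄′^d
(mod x_j)`» in polynomial dress). [OURS] [cite: CossartJannsenSaito2020, Thm. 3.10(4), Thm. 9.3] -/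
theorem divMonomial_step_mem_span_of_powerCone [DecidableEq K] {q : ℕ} (j : Fin 4) {b : Fin 4 → K}
    (hbj : b j = 0) {s : State K} {o : ℕ} (ho : ordZero s.F = o) (hr : ∀ d ∈ s.F.support, s.r ≤ d)
    (hqo : q < o) (ho2 : o < 2 * q) {a : K} {ℓ : Fin 4 → K} {d : ℕ}
    (hg : resForm s = C a * (∑ i, C (ℓ i) * X i) ^ d)
    (hℓb : ℓ j + ∑ i, ℓ i * b i * (if i = j then 0 else 1) = 0) :
    (CentreBlowup.step q Finset.univ j b s).F.divMonomial (CentreBlowup.step q Finset.univ j b s).r ∈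
      Ideal.span {(X j : MvPolynomial (Fin 4) K), (∑ i, C (Function.update ℓ j 0 i) * X i) ^ d} := by
  set G' := (CentreBlowup.step q Finset.univ j b s).F.divMonomial (CentreBlowup.step q Finset.univ j b s).r
  rw [show G' = (G' - PointBlowup.killVar j G') + PointBlowup.killVar j G' from (sub_add_cancel _ _).symm]
  refine Ideal.add_mem _ ?_ ?_
  · exact Ideal.span_mono (Set.singleton_subset_iff.mpr (Set.mem_insert _ _)) (sub_killVar_mem_span_X j G')
  · rw [killVar_divMonomial_step_of_powerCone j hbj ho hr hqo ho2 hg hℓb]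
    exact Ideal.mul_mem_left _ _ (Ideal.subset_span (Set.mem_insert_of_mem _ rfl))

/-- **Changing the representative**: `(x_j, L^d) = (x_j, M^d)` whenever `M − L ∈ (x_j)` — in particular for
`M` the new contact form / polynomial congruent to `L̃` modulo `x_j`. [folklore] -/
theorem span_X_pow_eq_of_sub_mem (j : Fin 4) {L M : MvPolynomial (Fin 4) K} (d : ℕ)
    (h : M - L ∈ Ideal.span {(X j : MvPolynomial (Fin 4) K)}) :
    Ideal.span {(X j : MvPolynomial (Fin 4) K), L ^ d} = Ideal.span {(X j : MvPolynomial (Fin 4) K), M ^ d} := by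
  have key : ∀ {L M : MvPolynomial (Fin 4) K}, M - L ∈ Ideal.span {(X j : MvPolynomial (Fin 4) K)} →
      M ^ d ∈ Ideal.span {(X j : MvPolynomial (Fin 4) K), L ^ d} := by
    intro L M hLM
    obtain ⟨c, hc⟩ := sub_dvd_pow_sub_pow M L d
    have hmem : M ^ d - L ^ d ∈ Ideal.span {(X j : MvPolynomial (Fin 4) K), L ^ d} := by
      rw [hc]
      exact Ideal.mul_mem_right _ _
        (Ideal.span_mono (Set.singleton_subset_iff.mpr (Set.mem_insert _ _)) hLM)
    rw [show M ^ d = (M ^ d - L ^ d) + L ^ d from (sub_add_cancel _ _).symm]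
    exact Ideal.add_mem _ hmem (Ideal.subset_span (Set.mem_insert_of_mem _ rfl))
  have hX : ∀ N : MvPolynomial (Fin 4) K,
      (X j : MvPolynomial (Fin 4) K) ∈ Ideal.span {(X j : MvPolynomial (Fin 4) K), N ^ d} :=
    fun N => Ideal.subset_span (Set.mem_insert _ _)
  have h' : L - M ∈ Ideal.span {(X j : MvPolynomial (Fin 4) K)} := by
    rw [← neg_sub]; exact Submodule.neg_mem _ h
  apply le_antisymm
  · rw [Ideal.span_le]
    intro x hx
    rcases hx with rfl | rfl
    · exact hX M
    · exact key h'
  · rw [Ideal.span_le]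
    intro x hx
    rcases hx with rfl | rfl
    · exact hX L
    · exact key h

end ResCone

end Summit.ResolutionOfSingularities.ResolutionOfSingularities.Theorems.PIDim4

end
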